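import Summits.AtomisticToContinuum.BoseEinsteinCondensation.Theses.BECStronglyRayleigh
import Summits.AtomisticToContinuum.BoseEinsteinCondensation.Theorems.LatticeODLROOffHalfFilling.Negative.OffHalfFillingPrelim

/-!
# Negative lemmas for crux `KineticLatticeBEC` (stmt-AtomisticToContinuum-9671), I: read-back and the
master inequality

Supports (does not close) stmt-AtomisticToContinuum-9671, the target of route `BECStronglyRayleigh`
(`∃ c > 0, ∃ L₀, ∀ even L ≥ L₀, ∀ 1 ≤ N ≤ L³/2, c·N·L³ ≤ Re ω_{H_pen(L,N)}((S¹_tot)²+(S²_tot)²) + N − L³/2`,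
`H_pen(L,N) = xyTorus 3 L 1 + 4L³•(S³_tot + (L³/2 − N)•1)²`, `ω` the tracial ground state). Nothing in
this family asserts a Theses statement positively.

* `kineticLatticeBEC_iff` : the crux is `∃ c > 0, ∃ L₀, KineticLatticeBECWith c L₀` with
  `rhs L N = Re ω(obsO) + N − L³/2` (definitional, `Iff.rfl`); `Hpen_isHermitian`.
* `obsO_eq` : `(S¹_tot)²+(S²_tot)² = (S⁺_tot)ᴴS⁺_tot + S³_tot` (`S⁺_x = E x`), `quad_obsO`.
* `re_quad_Hpen_ge` (★) : `Σ_σ [4L³(L³ − N − #↓σ)² − 3·#↓σ] |v_σ|² ≤ Re⟨v, H_pen(L,N) v⟩` for `L ≥ 3`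
  (saturation certificate `hmu_decomp` at `μ = 0` + the diagonal penalty `pen_mulVec_apply`).
* `Hpen_mulVec_upVec`, `groundEnergy_Hpen_le` : `|⇑⟩` is an eigenvector, `E₀ ≤ 4L³(L³ − N)²`;
  `re_quad_obsO_smul_upVec` : `Re⟨a⇑, O a⇑⟩ = (|Λ|/2)‖a⇑‖²`.

Companions: `FullFilling.lean` (`2N ≤ L³` is load-bearing), `CasimirCeiling.lean` (`c ≤ ½`),
`ParticleHole.lean` (`rhs(L,N) = rhs(L,L³−N) + 2N − L³`, cap-equivalence), `SectorToth.lean` (sector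
selection, Tóth's bound, fixed-hole caps refuted).
-/

noncomputable section

namespace Summit.AtomisticToContinuum.BoseEinsteinCondensation.Theorems.KineticLatticeBEC.Negative

open scoped BigOperators ComplexOrder
open Literature.MathematicalPhysics.QuantumLattice Literature.Probability.LatticeModels Matrix Finset
open Summit.AtomisticToContinuum.BoseEinsteinCondensation.Theses.BECStronglyRayleigh
open Summit.AtomisticToContinuum.BoseEinsteinCondensation.Theorems.LatticeODLROOffHalfFilling.Negative

/-! ### §0 The crux, verbatim pieces -/

section Defs

variable (L : ℕ) [NeZero L]

/-- The penalised XY Hamiltonian of the crux (verbatim the matrix fed to `groundStateFunctional`):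
`H_pen(L,N) = xyTorus 3 L 1 + 4L³ • (S³_tot + (L³/2 − N)•1)²`. [folklore] -/
abbrev Hpen (N : ℕ) : Op (TorusSite 3 L) 2 :=
  xyTorus 3 L 1 + (((3 + 1) * L ^ 3 : ℕ) : ℂ) •
    (totalSpin 1 2 + ((L : ℂ) ^ 3 / 2 - (N : ℂ)) • (1 : Op (TorusSite 3 L) 2)) ^ 2

/-- The crux's observable `(S¹_tot)² + (S²_tot)²` (verbatim). [folklore] -/
abbrev obsO (Λ : Type*) [Fintype Λ] [DecidableEq Λ] : Op Λ 2 :=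
  totalSpin 1 0 * totalSpin 1 0 + totalSpin 1 1 * totalSpin 1 1

/-- The right-hand side of the crux inequality: `Re ω_{H_pen(L,N)}((S¹_tot)²+(S²_tot)²) + N − L³/2`
(`= ω(S⁺_tot S⁻_tot) = L³ ·` zero-mode occupation when the ground state lies in the `N`-boson
sector). [folklore] -/
def rhs (N : ℕ) : ℝ :=
  ((Hpen L N).groundStateFunctional (obsO (TorusSite 3 L))).re + N - (L : ℝ) ^ 3 / 2

end Defs

/-- The crux with its two existential parameters exposed. [folklore] -/
def KineticLatticeBECWith (c : ℝ) (L₀ : ℕ) : Prop :=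
  ∀ (L : ℕ) [NeZero L], L₀ ≤ L → Even L → ∀ N : ℕ, 1 ≤ N → 2 * N ≤ L ^ 3 →
    c * N * (L : ℝ) ^ 3 ≤ rhs L N

/-- READ-BACK: the crux is literally `∃ c > 0, ∃ L₀, KineticLatticeBECWith c L₀`. [folklore] -/
theorem kineticLatticeBEC_iff :
    KineticLatticeBEC ↔ ∃ c : ℝ, 0 < c ∧ ∃ L₀ : ℕ, KineticLatticeBECWith c L₀ :=
  Iff.rfl

section Basics

variable (L : ℕ) [NeZero L]

/-- `|Λ| = L³` on the three-dimensional torus. [folklore] -/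
theorem card_site : Fintype.card (TorusSite 3 L) = L ^ 3 := by
  simp [TorusSite, ZMod.card]

/-- The XY torus Hamiltonian is the `μ = 0` member of the saturation family `Hmu`. [folklore] -/
theorem xyTorus_eq_Hmu_zero : xyTorus 3 L 1 = Hmu L 0 := by
  simp [Hmu, xyTorus]

/-- The penalty operator `S³_tot + (L³/2 − N)•1` is Hermitian. [folklore] -/
theorem pen_isHermitian (N : ℕ) :
    (totalSpin 1 2 + ((L : ℂ) ^ 3 / 2 - (N : ℂ)) • (1 : Op (TorusSite 3 L) 2)).IsHermitian := by
  refine (totalSpin_isHermitian 1 2).add ?_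
  have : ((L : ℂ) ^ 3 / 2 - (N : ℂ)) = (((L : ℝ) ^ 3 / 2 - (N : ℝ) : ℝ) : ℂ) := by push_cast; ring
  rw [this]
  exact isHermitian_one.ofReal_smul _
  where
  /-- helper: real scalar multiples of Hermitian matrices are Hermitian -/
  isHermitian_one : (1 : Op (TorusSite 3 L) 2).IsHermitian := Matrix.isHermitian_one

/-- `H_pen(L,N)` is Hermitian. [folklore] -/
theorem Hpen_isHermitian (N : ℕ) : (Hpen L N).IsHermitian := by
  refine (xxzHamiltonian_isHermitian 1 _ (-1) 0).add ?_
  have h2 : ((totalSpin 1 2 + ((L : ℂ) ^ 3 / 2 - (N : ℂ)) • (1 : Op (TorusSite 3 L) 2)) ^ 2).IsHermitian :=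
    (pen_isHermitian L N).pow 2
  have : (((3 + 1) * L ^ 3 : ℕ) : ℂ) = ((((3 + 1) * L ^ 3 : ℕ) : ℝ) : ℂ) := by push_cast; ring
  rw [this]
  exact h2.ofReal_smul _

end Basics


/-! ### §1 The master inequality: the quadratic form of `H_pen` in the configuration basis -/

section Master

variable {Λ : Type*} [Fintype Λ] [DecidableEq Λ]

/-- `(N↓ v)(σ) = (#↓σ) · v(σ)`: the down-spin number operator is diagonal. [folklore] -/
theorem sumPd_mulVec_apply (v : TensorIndex Λ 2 → ℂ) (σ : TensorIndex Λ 2) :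
    ((∑ x : Λ, Pd x) *ᵥ v) σ = (downCount σ : ℂ) * v σ := by
  rw [Matrix.sum_mulVec, Finset.sum_apply]
  simp_rw [Pd_mulVec_apply]
  rw [Finset.sum_ite, Finset.sum_const_zero, add_zero, Finset.sum_const, nsmul_eq_mul, downCount]

/-- `⟨v, N↓ v⟩ = Σ_σ (#↓σ) ‖v σ‖²`. [folklore] -/
theorem quad_sumPd (v : TensorIndex Λ 2 → ℂ) :
    star v ⬝ᵥ (∑ x : Λ, Pd x) *ᵥ v = ((∑ σ, (downCount σ : ℝ) * ‖v σ‖ ^ 2 : ℝ) : ℂ) := by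
  rw [dotProduct]
  push_cast
  refine Finset.sum_congr rfl fun σ _ => ?_
  rw [Pi.star_apply, sumPd_mulVec_apply, Complex.star_def, ← Complex.conj_mul']
  ring

variable (L : ℕ) [NeZero L]

/-- The penalty operator of the crux, `S³_tot + (L³/2 − N)•1` (`= n_up − N`, diagonal). [folklore] -/
abbrev pen (N : ℕ) : Op (TorusSite 3 L) 2 :=
  totalSpin 1 2 + ((L : ℂ) ^ 3 / 2 - (N : ℂ)) • (1 : Op (TorusSite 3 L) 2)

/-- `H_pen = H_XY + 4L³ • pen²` (definitional). [folklore] -/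
theorem Hpen_eq (N : ℕ) :
    Hpen L N = xyTorus 3 L 1 + (((3 + 1) * L ^ 3 : ℕ) : ℂ) • pen L N ^ 2 := rfl

/-- **The penalty is diagonal**: `(pen v)(σ) = (L³ − N − #↓σ) v(σ) = (n_up(σ) − N) v(σ)`. [folklore] -/
theorem pen_mulVec_apply (N : ℕ) (v : TensorIndex (TorusSite 3 L) 2 → ℂ) (σ : TensorIndex (TorusSite 3 L) 2) :
    (pen L N *ᵥ v) σ = ((L : ℂ) ^ 3 - N - downCount σ) * v σ := by
  rw [add_mulVec, smul_mulVec, one_mulVec, Pi.add_apply, Pi.smul_apply, smul_eq_mul,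
    totalSpin_two_eq, sub_mulVec, smul_mulVec, one_mulVec, Pi.sub_apply, Pi.smul_apply,
    smul_eq_mul, sumPd_mulVec_apply, card_site]
  push_cast
  ring

/-- `⟨v, pen² v⟩ = Σ_σ (L³ − N − #↓σ)² ‖v σ‖²`. [folklore] -/
theorem quad_penSq (N : ℕ) (v : TensorIndex (TorusSite 3 L) 2 → ℂ) :
    star v ⬝ᵥ (pen L N ^ 2) *ᵥ v =
      ((∑ σ, ((L : ℝ) ^ 3 - N - downCount σ) ^ 2 * ‖v σ‖ ^ 2 : ℝ) : ℂ) := by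
  rw [pow_two, ← mulVec_mulVec, dotProduct]
  push_cast
  refine Finset.sum_congr rfl fun σ _ => ?_
  rw [Pi.star_apply, pen_mulVec_apply, pen_mulVec_apply, Complex.star_def, ← Complex.conj_mul']
  ring

/-- **Kinetic energy versus down-spin number**: `Re⟨v, H_XY v⟩ ≥ −3 Σ_σ (#↓σ)‖v σ‖²`, i.e.
`H_XY + 3N↓ ≥ 0` — the saturation certificate `hmu_decomp` at `μ = 0`. [folklore] -/
theorem re_quad_xy_ge (hL : 3 ≤ L) (v : TensorIndex (TorusSite 3 L) 2 → ℂ) :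
    -(3 * ∑ σ, (downCount σ : ℝ) * ‖v σ‖ ^ 2) ≤ (star v ⬝ᵥ (xyTorus 3 L 1) *ᵥ v).re := by
  rw [xyTorus_eq_Hmu_zero, hmu_decomp L hL 0]
  rw [add_mulVec, add_mulVec, dotProduct_add, dotProduct_add, Complex.add_re, Complex.add_re,
    smul_mulVec, smul_mulVec, smul_mulVec, one_mulVec, dotProduct_smul, dotProduct_smul,
    dotProduct_smul, smul_eq_mul, smul_eq_mul, smul_eq_mul, Complex.re_ofReal_mul,
    Complex.re_ofReal_mul, Complex.re_ofReal_mul, quad_sumPd, Complex.ofReal_re]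
  have hsos : 0 ≤ (star v ⬝ᵥ (∑ x : TorusSite 3 L, ∑ i : Fin 3,
      (E x - E (x + Pi.single i 1))ᴴ * (E x - E (x + Pi.single i 1))) *ᵥ v).re := by
    rw [Matrix.sum_mulVec, dotProduct_sum, Complex.re_sum]
    refine Finset.sum_nonneg fun x _ => ?_
    rw [Matrix.sum_mulVec, dotProduct_sum, Complex.re_sum]
    refine Finset.sum_nonneg fun i _ => ?_
    rw [star_dotProduct_conjTranspose_mul_mulVec]
    exact (Complex.nonneg_iff.mp (dotProduct_star_self_nonneg _)).1
  have h0 : -(0 * (Fintype.card (TorusSite 3 L) : ℝ) / 2) * (star v ⬝ᵥ v).re = 0 := by ring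
  rw [h0, zero_add]
  nlinarith [hsos]

/-- **MASTER INEQUALITY (★).** For `L ≥ 3`, every `N` and every vector `v`:
`Σ_σ [4L³(L³ − N − #↓σ)² − 3·#↓σ] ‖v σ‖² ≤ Re⟨v, H_pen(L,N) v⟩`.
The bracket is `4L³(n_up(σ) − N)² − 3(L³ − n_up(σ))`: at least `L³ > 0` off the `N`-sector, and
`−3(L³ − N) ≤ 0` on it. Every finding below is read off this one line. [folklore] -/
theorem re_quad_Hpen_ge (hL : 3 ≤ L) (N : ℕ) (v : TensorIndex (TorusSite 3 L) 2 → ℂ) :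
    ∑ σ, (4 * (L : ℝ) ^ 3 * ((L : ℝ) ^ 3 - N - downCount σ) ^ 2 - 3 * downCount σ) * ‖v σ‖ ^ 2 ≤
      (star v ⬝ᵥ (Hpen L N) *ᵥ v).re := by
  have h1 := re_quad_xy_ge L hL v
  have hc : (((3 + 1) * L ^ 3 : ℕ) : ℂ) = ((4 * (L : ℝ) ^ 3 : ℝ) : ℂ) := by push_cast; ring
  rw [Hpen_eq, add_mulVec, dotProduct_add, Complex.add_re, smul_mulVec, dotProduct_smul,
    smul_eq_mul, hc, quad_penSq, ← Complex.ofReal_mul, Complex.ofReal_re]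
  have hsplit : ∑ σ, (4 * (L : ℝ) ^ 3 * ((L : ℝ) ^ 3 - N - downCount σ) ^ 2 - 3 * downCount σ) *
      ‖v σ‖ ^ 2 = 4 * (L : ℝ) ^ 3 * ∑ σ, ((L : ℝ) ^ 3 - N - downCount σ) ^ 2 * ‖v σ‖ ^ 2 -
        3 * ∑ σ, (downCount σ : ℝ) * ‖v σ‖ ^ 2 := by
    rw [Finset.mul_sum, Finset.mul_sum, ← Finset.sum_sub_distrib]
    refine Finset.sum_congr rfl fun σ _ => ?_
    ring
  rw [hsplit]
  linarith

end Master

section UpVec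

variable {Λ : Type*} [Fintype Λ] [DecidableEq Λ]

omit [DecidableEq Λ] in
/-- A configuration has no down spin iff it is the all-up configuration. [folklore] -/
theorem downCount_eq_zero_iff (σ : TensorIndex Λ 2) : downCount σ = 0 ↔ σ = fun _ => 0 := by
  rw [downCount, Finset.card_eq_zero, Finset.filter_eq_empty_iff]
  constructor
  · intro h
    funext x
    have hx := h (Finset.mem_univ x)
    rcases Fin.exists_fin_two.mp ⟨σ x, rfl⟩ with h0 | h1
    · exact h0
    · exact absurd h1 hx
  · rintro rfl x _
    simp

/-- `(S¹_tot)² + (S²_tot)² = Σ_{x,y} (S¹_xS¹_y + S²_xS²_y)`. [folklore] -/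
theorem obsO_eq_sum_hop : obsO Λ = ∑ x : Λ, ∑ y : Λ, hop x y := by
  simp only [obsO, totalSpin, Finset.sum_mul_sum, hop, Finset.sum_add_distrib]

/-- **The order-parameter operator of the crux**: `(S¹_tot)² + (S²_tot)² = (S⁺_tot)ᴴ S⁺_tot + S³_tot`
with `S⁺_tot = Σ_x E x` (so `RHS = ω((S¹)²+(S²)²) + ω(S³) = ω(S⁺_tot S⁻_tot)` in the `N`-sector).
[folklore] -/
theorem obsO_eq : obsO Λ = (∑ x : Λ, E x)ᴴ * (∑ x : Λ, E x) + totalSpin 1 2 := by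
  rw [obsO_eq_sum_hop, sum_hop_eq]

/-- `⟨v, O v⟩ = ‖S⁺_tot v‖² + ⟨v, S³_tot v⟩`. [folklore] -/
theorem quad_obsO (v : TensorIndex Λ 2 → ℂ) :
    star v ⬝ᵥ (obsO Λ) *ᵥ v =
      star ((∑ x : Λ, E x) *ᵥ v) ⬝ᵥ ((∑ x : Λ, E x) *ᵥ v) + star v ⬝ᵥ (totalSpin 1 2) *ᵥ v := by
  rw [obsO_eq, add_mulVec, dotProduct_add, star_dotProduct_conjTranspose_mul_mulVec]

/-- `S⁺_tot |⇑⟩ = 0`. [folklore] -/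
theorem sumE_mulVec_upVec : (∑ x : Λ, E x) *ᵥ (upVec : TensorIndex Λ 2 → ℂ) = 0 := by
  rw [Matrix.sum_mulVec]
  exact Finset.sum_eq_zero fun x _ => E_mulVec_upVec x

/-- `S³_tot |⇑⟩ = (|Λ|/2) |⇑⟩`. [folklore] -/
theorem totalSpin_two_mulVec_upVec :
    (totalSpin 1 2 : Op Λ 2) *ᵥ upVec = ((Fintype.card Λ : ℂ) / 2) • (upVec : TensorIndex Λ 2 → ℂ) := by
  have h := totalSpin_two_mulVec_single (Λ := Λ) (fun _ => (0 : Fin 2))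
  rw [(downCount_eq_zero_iff _).mpr rfl, Nat.cast_zero, sub_zero] at h
  exact h

/-- On the ray of `|⇑⟩` the order parameter is exactly `|Λ|/2` per unit norm:
`Re⟨a⇑, O a⇑⟩ = (|Λ|/2)‖a⇑‖²`. [folklore] -/
theorem re_quad_obsO_smul_upVec (a : ℂ) :
    (star (a • (upVec : TensorIndex Λ 2 → ℂ)) ⬝ᵥ (obsO Λ) *ᵥ (a • upVec)).re =
      (Fintype.card Λ : ℝ) / 2 * (star (a • (upVec : TensorIndex Λ 2 → ℂ)) ⬝ᵥ (a • upVec)).re := by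
  rw [quad_obsO, mulVec_smul, sumE_mulVec_upVec, smul_zero, dotProduct_zero, zero_add, mulVec_smul,
    totalSpin_two_mulVec_upVec, smul_comm, dotProduct_smul, smul_eq_mul]
  have : ((Fintype.card Λ : ℂ) / 2) = (((Fintype.card Λ : ℝ) / 2 : ℝ) : ℂ) := by push_cast; ring
  rw [this, Complex.re_ofReal_mul]

variable (L : ℕ) [NeZero L]

/-- `pen |⇑⟩ = (L³ − N) |⇑⟩`. [folklore] -/
theorem pen_mulVec_upVec (N : ℕ) :
    pen L N *ᵥ upVec = ((L : ℂ) ^ 3 - N) • (upVec : TensorIndex (TorusSite 3 L) 2 → ℂ) := by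
  ext σ
  rw [pen_mulVec_apply, Pi.smul_apply, smul_eq_mul]
  by_cases hσ : σ = fun _ => 0
  · subst hσ
    rw [(downCount_eq_zero_iff _).mpr rfl, Nat.cast_zero, sub_zero]
  · have h0 : (upVec : TensorIndex (TorusSite 3 L) 2 → ℂ) σ = 0 := by
      rw [upVec, Pi.single_apply, if_neg hσ]
    rw [h0, mul_zero, mul_zero]

/-- `H_pen(L,N) |⇑⟩ = 4L³(L³ − N)² |⇑⟩`: the all-up vector is always an eigenvector. [folklore] -/
theorem Hpen_mulVec_upVec (hL : 3 ≤ L) (N : ℕ) :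
    Hpen L N *ᵥ upVec = ((((3 + 1) * L ^ 3 : ℕ) : ℂ) * ((L : ℂ) ^ 3 - N) ^ 2) • upVec := by
  rw [Hpen_eq, add_mulVec, xyTorus_eq_Hmu_zero, hmu_mulVec_upVec L hL 0, smul_mulVec, pow_two,
    ← mulVec_mulVec, pen_mulVec_upVec, mulVec_smul, pen_mulVec_upVec, smul_smul, smul_smul]
  have : ((-(0 * (Fintype.card (TorusSite 3 L) : ℝ) / 2) : ℝ) : ℂ) = 0 := by push_cast; ring
  rw [this, zero_smul, zero_add, pow_two, mul_assoc]

/-- Variational bound `E₀(H_pen(L,N)) ≤ 4L³(L³ − N)²` (trial state `|⇑⟩`). [folklore] -/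
theorem groundEnergy_Hpen_le (hL : 3 ≤ L) (N : ℕ) :
    (Hpen L N).groundEnergy ≤ 4 * (L : ℝ) ^ 3 * ((L : ℝ) ^ 3 - N) ^ 2 := by
  have h := groundEnergy_le_rayleigh_holds (Hpen_isHermitian L N) upVec star_upVec_dotProduct_upVec
  rw [Hpen_mulVec_upVec L hL N, dotProduct_smul, star_upVec_dotProduct_upVec, smul_eq_mul,
    mul_one] at h
  have hc : ((((3 + 1) * L ^ 3 : ℕ) : ℂ) * ((L : ℂ) ^ 3 - N) ^ 2) =
      ((4 * (L : ℝ) ^ 3 * ((L : ℝ) ^ 3 - N) ^ 2 : ℝ) : ℂ) := by push_cast; ring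
  rwa [hc, Complex.ofReal_re] at h

end UpVec

end Summit.AtomisticToContinuum.BoseEinsteinCondensation.Theorems.KineticLatticeBEC.Negative
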